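import Literature.Analysis.Fourier.StationaryPhaseLog
import HarnessLib

/-!
# Stationary phase UNIFORM in the position of the end-point: the incomplete-Fresnel main term

Topic `Literature/Analysis/Fourier`, sequel to `StationaryPhaseLog.lean` (whose one-sided machinery `LogStatPhaseHyp` — the
exact substitution `u = τ(x) = S(x)/L`, `S = (2L(P − P(c)))^{1/2}`, the defect `1 − τ'` and its primitive bound — is reused
verbatim).  Everything here is PROVED; no definitions, no named facts.

`StationaryPhaseLog.lean` proves, for `P` with three derivatives on `[c, β]`, `r ≤ P'' ≤ Ar`, `|P'''| ≤ λ₃`, `P'(c) = 0`,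

  `‖∫_c^β e^{iP} − e^{iP(c)} · fresnelLim · P''(c)^{−1/2}‖ ≤ 2/(r(β − c)) + 2A³(λ₃/r²)(1 + log(1 + (β − c)√r))`

(`fresnelLim = ∫_0^∞ e^{iu²/2} du = 𝔣/2`).  The term `2/(r(β − c))` is the price of replacing the INCOMPLETE Fresnel integral
`fresnelS(X) = ∫_0^X e^{iu²/2} du` at `X = (2(P(β) − P(c)))^{1/2}` by its limit; it is as large as the main term `≍ r^{−1/2}` when
the end-point `β` lies within the Fresnel zone `β − c ≲ r^{−1/2}` of the stationary point, so the lemma says nothing when the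
stationary point is close to (or, after splitting an interval, AT) an end-point of the range of integration.  Keeping the
incomplete Fresnel integral as the main term removes that term and nothing else:

* `LogStatPhaseHyp.norm_integral_sub_fresnelS_le` — **uniform one-sided stationary phase**: under the same hypotheses,
  `‖∫_c^β e^{iP(x)} dx − e^{iP(c)} P''(c)^{−1/2} fresnelS((2(P(β) − P(c)))^{1/2})‖ ≤ 2A³(λ₃/r²)(1 + log(1 + (β − c)√r))`,
  valid for EVERY `β > c` with a right-hand side that stays bounded as `β ↓ c` (both sides tend to `0` then); the variable of the
  Fresnel integral is the exact phase increment `(2(P(β) − P(c)))^{1/2} = S(β)/L^{1/2}`, not its quadratic model `L^{1/2}(β − c)`;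
* `stationaryPhase_uniform_right` / `stationaryPhase_uniform_left` — the same with explicit hypotheses on `[c, β]`, resp. on
  `[α, c]` (stationary point at the RIGHT end, by the reflection `x ↦ 2c − x`; main term
  `e^{iP(c)} P''(c)^{−1/2} fresnelS((2(P(α) − P(c)))^{1/2})`);
* `stationaryPhase_uniform` — the two-sided form on `[α, β]` with `α ≤ c ≤ β` (end-points AT the stationary point allowed):
  `‖∫_α^β e^{iP} − e^{iP(c)} P''(c)^{−1/2} (fresnelS((2(P(α) − P(c)))^{1/2}) + fresnelS((2(P(β) − P(c)))^{1/2}))‖`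
  `≤ 2A³(λ₃/r²)(2 + log(1 + (c − α)√r) + log(1 + (β − c)√r))`;
* `stationaryPhase_uniform_right_neg` — the concave case `r ≤ −P'' ≤ Ar` on `[c, β]` (conjugation), main term
  `e^{iP(c)} |P''(c)|^{−1/2} conj(fresnelS((2(P(c) − P(β)))^{1/2}))`.

With `‖fresnelS X − fresnelLim‖ ≤ 2/X` (`norm_fresnelS_sub_fresnelLim_le`) and `S(β) ≥ r(β − c)` these give back
`norm_integral_sub_main_le` / `stationaryPhase_log`; at `β = c` the main term vanishes; in between they describe the Fresnel
transition (in optics: diffraction at a straight edge).  This uniform form is what a stationary point drifting through a FIXED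
cut requires — e.g. the «uniform tail–Fresnel law» of the Li column (cell `pub/rh-li`, round 9), where the stationary height
`t₀(m) = √(n/log m − ¼)` of the prime power `m` crosses the cut `c√n` as `c` passes `(log m)^{−1/2}`.

## References

* E. C. Titchmarsh, *The Theory of the Riemann Zeta-Function*, 2nd ed. (1986), Lemma 4.6. [Titchmarsh1986]
* S. W. Graham, G. Kolesnik, *Van der Corput's Method of Exponential Sums*, LMS LN 126 (1991), Lemma 3.4. [GrahamKolesnik1991]
* M. N. Huxley, *Area, Lattice Points and Exponential Sums*, OUP 1996, §5.1. [Huxley1996]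
* (uniform Fresnel transition near an end-point: B. Engquist, A. Fokas, E. Hairer, A. Iserles (eds.), *Highly Oscillatory
  Problems*, CUP 2009, pp. 37–41; W. C. Chew, *Waves and Fields in Inhomogeneous Media*, 1990, p. 90 — background only.)
-/

noncomputable section

open MeasureTheory Set intervalIntegral Complex Filter Topology

namespace Literature.Analysis.Fourier

/-! ### The Fresnel variable -/

/-- `√(2Lv)/√L = √(2v)` for `L > 0`: the Fresnel variable `S(β)/L^{1/2}` is the phase increment `(2(P(β) − P(c)))^{1/2}`.
[folklore] -/
private theorem sqrt_two_mul_mul_div_sqrt {L v : ℝ} (hL : 0 < L) :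
    Real.sqrt (2 * L * v) / Real.sqrt L = Real.sqrt (2 * v) := by
  have hs : 0 < Real.sqrt L := Real.sqrt_pos.2 hL
  rw [show 2 * L * v = L * (2 * v) by ring, Real.sqrt_mul hL.le, mul_div_cancel_left₀ _ hs.ne']

namespace LogStatPhaseHyp

variable {P P' P'' P''' : ℝ → ℝ} {c β r A lam3 : ℝ} (H : LogStatPhaseHyp P P' P'' P''' c β r A lam3)
include H

/-- `S(β)/P''(c)^{1/2} = (2(P(β) − P(c)))^{1/2}`: the upper limit of the model integral after the substitution
`u = τ(x)`. [cite: Titchmarsh1986, Lemma 4.6 (proof)] -/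
theorem S_div_sqrt_eq (x : ℝ) : H.S x / Real.sqrt (P'' c) = Real.sqrt (2 * (P x - P c)) := by
  rw [H.S_def]
  exact sqrt_two_mul_mul_div_sqrt H.L_pos

/-- **The main part is an incomplete Fresnel integral, exactly**:
`∫_c^β τ'(x) e^{iP(x)} dx = e^{iP(c)} P''(c)^{−1/2} fresnelS((2(P(β) − P(c)))^{1/2})`.
[cite: Titchmarsh1986, Lemma 4.6 (proof)] [cite: GrahamKolesnik1991, Lemma 3.4 (proof)] -/
theorem integral_ratio_mul_exp_eq_fresnelS :
    ∫ x in c..β, (H.ratio x : ℂ) * Complex.exp (I * P x)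
      = Complex.exp (I * P c) * ((Real.sqrt (P'' c))⁻¹ : ℝ) * fresnelS (Real.sqrt (2 * (P β - P c))) := by
  have hL := H.L_pos
  rw [H.integral_ratio_mul_exp_eq, integral_quadratic_phase_right_eq hL, mul_assoc]
  congr 3
  rw [← H.S_div_sqrt_eq β, div_mul_eq_mul_div, div_eq_div_iff hL.ne' (Real.sqrt_pos.2 hL).ne']
  nth_rw 3 [← Real.mul_self_sqrt hL.le]
  ring

/-- **The defect part** `∫_c^β (1 − τ') e^{iP}`: trivially `O(Aλ₃/r²)` on `[c, c + r^{−1/2}]`, and by one integration by parts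
`O(A³(λ₃/r²) log((β − c)√r))` beyond; in total
`‖∫_c^β (1 − τ'(x)) e^{iP(x)} dx‖ ≤ A(λ₃/r²) + 2A³(λ₃/r²) log(1 + (β − c)√r)` — uniformly in `β > c`.
[cite: GrahamKolesnik1991, Lemma 3.4 (proof)] -/
theorem norm_integral_defect_le :
    ‖∫ x in c..β, ((1 - H.ratio x : ℝ) : ℂ) * Complex.exp (I * P x)‖
      ≤ A * (lam3 / r ^ 2) + 2 * A ^ 3 * (lam3 / r ^ 2) * Real.log (1 + (β - c) * Real.sqrt r) := by
  have hcβ := H.hcβ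
  have hr := H.hr
  have hA := (lt_of_lt_of_le one_pos H.hA)
  have hA1 := H.hA
  have hl := H.lam3_nonneg
  have hL := H.L_pos
  have hβI : β ∈ Icc c β := right_mem_Icc.2 hcβ.le
  -- notation
  set E : ℝ → ℂ := fun x => Complex.exp (I * P x) with hE
  have hEc : ContinuousOn E (Icc c β) := continuousOn_exp_I_mul H.hP
  have hEn : ∀ x, ‖E x‖ = 1 := fun x => norm_exp_I_mul_ofReal (P x)
  have hi2 : ∀ p ∈ Icc c β, ∀ q ∈ Icc c β, IntervalIntegrable (fun x => ((1 - H.ratio x : ℝ) : ℂ) * E x) volume p q := by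
    intro p hp q hq
    refine (ContinuousOn.mul ?_ hEc).mono (uIcc_subset_Icc hp hq) |>.intervalIntegrable
    exact Complex.continuous_ofReal.comp_continuousOn (continuousOn_const.sub H.continuousOn_ratio)
  -- split at `x₁ = c + η₁`
  set η₁ : ℝ := min (1 / Real.sqrt r) (β - c) with hη₁
  have hsr : 0 < Real.sqrt r := Real.sqrt_pos.2 hr
  have hη₁0 : 0 < η₁ := lt_min (by positivity) (sub_pos.2 hcβ)
  have hη₁1 : η₁ ≤ 1 / Real.sqrt r := min_le_left _ _
  have hη₁2 : η₁ ≤ β - c := min_le_right _ _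
  set x₁ : ℝ := c + η₁ with hx₁
  have hcx₁ : c < x₁ := by rw [hx₁]; linarith
  have hx₁β : x₁ ≤ β := by rw [hx₁]; linarith
  have hx₁I : x₁ ∈ Icc c β := ⟨hcx₁.le, hx₁β⟩
  have hη₁sq : η₁ ^ 2 ≤ 1 / r := by
    calc η₁ ^ 2 ≤ (1 / Real.sqrt r) ^ 2 := pow_le_pow_left₀ hη₁0.le hη₁1 2
      _ = 1 / r := by rw [div_pow, one_pow, Real.sq_sqrt hr.le]
  -- C1: the short piece
  have hC1 : ‖∫ x in c..x₁, ((1 - H.ratio x : ℝ) : ℂ) * E x‖ ≤ A / 3 * (lam3 / r ^ 2) := by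
    have hb : ∀ x ∈ Set.uIoc c x₁, ‖((1 - H.ratio x : ℝ) : ℂ) * E x‖ ≤ A / 3 * (lam3 / r) * η₁ := by
      intro x hx
      rw [uIoc_of_le hcx₁.le] at hx
      rw [norm_mul, hEn, mul_one, Complex.norm_real, Real.norm_eq_abs, abs_sub_comm]
      have := H.abs_ratio_sub_one_le' ⟨hx.1.le, hx.2.trans hx₁β⟩
      refine this.trans ?_
      have hK0 : 0 ≤ A / 3 * (lam3 / r) := by positivity
      exact mul_le_mul_of_nonneg_left (by rw [hx₁] at hx; linarith [hx.2]) hK0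
    refine (intervalIntegral.norm_integral_le_of_norm_le_const hb).trans ?_
    rw [show x₁ - c = η₁ by rw [hx₁]; ring, abs_of_pos hη₁0]
    calc A / 3 * (lam3 / r) * η₁ * η₁ = A / 3 * (lam3 / r) * η₁ ^ 2 := by ring
      _ ≤ A / 3 * (lam3 / r) * (1 / r) := by gcongr
      _ = A / 3 * (lam3 / r ^ 2) := by field_simp
  -- C2: the long piece, by parts
  have hC2 : ‖∫ x in x₁..β, ((1 - H.ratio x : ℝ) : ℂ) * E x‖
      ≤ 2 * (A / 3 * (lam3 / r ^ 2)) + 2 * A ^ 3 * (lam3 / r ^ 2) * Real.log ((β - c) / η₁) := by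
    have hsub : Icc x₁ β ⊆ Ioc c β := fun x hx => ⟨hcx₁.trans_le hx.1, hx.2⟩
    have hsub' : Icc x₁ β ⊆ Icc c β := fun x hx => Ioc_subset_Icc_self (hsub hx)
    have huI : uIcc x₁ β = Icc x₁ β := uIcc_of_le hx₁β
    -- `u = -I q`, `v = E`
    set qd : ℝ → ℝ := fun x => -(P'' x) / (P' x) ^ 2 + (P'' c * P' x / H.S x) / (H.S x) ^ 2 with hqd
    have hu : ∀ x ∈ uIcc x₁ β, HasDerivAt (fun x => -I * (H.q x : ℂ)) (-I * (qd x : ℂ)) x := by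
      intro x hx; rw [huI] at hx
      exact ((H.hasDerivAt_q (hsub hx)).ofReal_comp).const_mul (-I)
    have hv : ∀ x ∈ uIcc x₁ β, HasDerivAt E (I * P' x * E x) x := by
      intro x hx; rw [huI] at hx
      exact hasDerivAt_exp_I_mul (H.hP x (hsub' hx))
    have hqdc : ContinuousOn qd (Icc x₁ β) := by
      have hP'c := H.continuousOn_P'.mono hsub'
      have hP''c := H.continuousOn_P''.mono hsub'
      have hSc := H.continuousOn_S.mono hsub'
      have hP'0 : ∀ x ∈ Icc x₁ β, P' x ≠ 0 := fun x hx => (H.deriv_pos (hsub hx)).ne'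
      have hS0 : ∀ x ∈ Icc x₁ β, H.S x ≠ 0 := fun x hx => (H.S_pos (hsub hx)).ne'
      rw [hqd]
      refine ContinuousOn.add (hP''c.neg.div (hP'c.pow 2) fun x hx => pow_ne_zero 2 (hP'0 x hx)) ?_
      refine ContinuousOn.div ((continuousOn_const.mul hP'c).div hSc hS0) (hSc.pow 2)
        fun x hx => pow_ne_zero 2 (hS0 x hx)
    have hu' : IntervalIntegrable (fun x => -I * (qd x : ℂ)) volume x₁ β := by
      refine (ContinuousOn.intervalIntegrable ?_)
      rw [huI]
      exact continuousOn_const.mul (Complex.continuous_ofReal.comp_continuousOn hqdc)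
    have hv' : IntervalIntegrable (fun x => I * P' x * E x) volume x₁ β := by
      refine (ContinuousOn.intervalIntegrable ?_)
      rw [huI]
      exact (continuousOn_const.mul (Complex.continuous_ofReal.comp_continuousOn (H.continuousOn_P'.mono hsub'))).mul
        (hEc.mono hsub')
    have hparts := intervalIntegral.integral_mul_deriv_eq_deriv_mul hu hv hu' hv'
    -- the integrand `(1 - τ')E = (-I q) · (I P' E)` on `[x₁, β]`
    have hint : (∫ x in x₁..β, ((1 - H.ratio x : ℝ) : ℂ) * E x)
        = ∫ x in x₁..β, (-I * (H.q x : ℂ)) * (I * P' x * E x) := by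
      refine intervalIntegral.integral_congr fun x hx => ?_
      rw [huI] at hx
      have hxc : c < x := hcx₁.trans_le hx.1
      have hP0 : P' x ≠ 0 := (H.deriv_pos (hsub hx)).ne'
      have hS0 : H.S x ≠ 0 := (H.S_pos (hsub hx)).ne'
      have h1 : 1 - H.ratio x = H.q x * P' x := by
        rw [H.ratio_of_gt hxc, q_def]; field_simp
      rw [h1]
      push_cast
      have hre : (-I * (H.q x : ℂ)) * (I * P' x * E x) = -(I * I) * ((H.q x : ℂ) * P' x * E x) := by ring
      rw [hre, Complex.I_mul_I]
      ring
    rw [hint, hparts]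
    -- bounds
    have hqβ := H.abs_q_le ⟨hcβ, le_rfl⟩
    have hqx₁ := H.abs_q_le ⟨hcx₁, hx₁β⟩
    have hbd1 : ‖-I * (H.q β : ℂ) * E β‖ ≤ A / 3 * (lam3 / r ^ 2) := by
      rw [norm_mul, norm_mul, norm_neg, Complex.norm_I, one_mul, hEn, mul_one, Complex.norm_real, Real.norm_eq_abs]
      exact hqβ
    have hbd2 : ‖-I * (H.q x₁ : ℂ) * E x₁‖ ≤ A / 3 * (lam3 / r ^ 2) := by
      rw [norm_mul, norm_mul, norm_neg, Complex.norm_I, one_mul, hEn, mul_one, Complex.norm_real, Real.norm_eq_abs]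
      exact hqx₁
    have hbd3 : ‖∫ x in x₁..β, -I * (qd x : ℂ) * E x‖ ≤ 2 * A ^ 3 * (lam3 / r ^ 2) * Real.log ((β - c) / η₁) := by
      have hb : ∀ᵐ x : ℝ, x ∈ Ioc x₁ β → ‖-I * (qd x : ℂ) * E x‖ ≤ 2 * A ^ 3 * lam3 / r ^ 2 * (x - c)⁻¹ := by
        refine Eventually.of_forall fun x hx => ?_
        rw [norm_mul, norm_mul, norm_neg, Complex.norm_I, one_mul, hEn, mul_one, Complex.norm_real, Real.norm_eq_abs]
        have := H.abs_qderiv_le ⟨hcx₁.trans hx.1, hx.2⟩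
        rw [hqd]
        refine this.trans (le_of_eq ?_)
        field_simp
      have hgi : IntervalIntegrable (fun x => 2 * A ^ 3 * lam3 / r ^ 2 * (x - c)⁻¹) volume x₁ β := by
        refine ContinuousOn.intervalIntegrable ?_
        rw [huI]
        refine continuousOn_const.mul (ContinuousOn.inv₀ (continuousOn_id.sub continuousOn_const) ?_)
        intro x hx; exact (sub_pos.2 (hcx₁.trans_le hx.1)).ne'
      refine (intervalIntegral.norm_integral_le_of_norm_le hx₁β hb hgi).trans (le_of_eq ?_)
      rw [intervalIntegral.integral_const_mul, intervalIntegral.integral_comp_sub_right (fun x => x⁻¹) c,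
        integral_inv_of_pos (by linarith) (by linarith)]
      rw [show x₁ - c = η₁ by rw [hx₁]; ring]
      ring
    calc ‖-I * (H.q β : ℂ) * E β - -I * (H.q x₁ : ℂ) * E x₁ - ∫ x in x₁..β, -I * (qd x : ℂ) * E x‖
        ≤ ‖-I * (H.q β : ℂ) * E β‖ + ‖-I * (H.q x₁ : ℂ) * E x₁‖ + ‖∫ x in x₁..β, -I * (qd x : ℂ) * E x‖ := by
          have h1 := norm_sub_le (-I * (H.q β : ℂ) * E β - -I * (H.q x₁ : ℂ) * E x₁) (∫ x in x₁..β, -I * (qd x : ℂ) * E x)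
          have h2 := norm_sub_le (-I * (H.q β : ℂ) * E β) (-I * (H.q x₁ : ℂ) * E x₁)
          linarith
      _ ≤ A / 3 * (lam3 / r ^ 2) + A / 3 * (lam3 / r ^ 2) + 2 * A ^ 3 * (lam3 / r ^ 2) * Real.log ((β - c) / η₁) := by
          gcongr
      _ = 2 * (A / 3 * (lam3 / r ^ 2)) + 2 * A ^ 3 * (lam3 / r ^ 2) * Real.log ((β - c) / η₁) := by ring
  -- the logarithm
  have hlog : Real.log ((β - c) / η₁) ≤ Real.log (1 + (β - c) * Real.sqrt r) := by
    refine Real.log_le_log (div_pos (sub_pos.2 hcβ) hη₁0) ?_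
    rw [div_le_iff₀ hη₁0, hη₁]
    rcases le_total (1 / Real.sqrt r) (β - c) with h | h
    · rw [min_eq_left h]
      have : (1 + (β - c) * Real.sqrt r) * (1 / Real.sqrt r) = 1 / Real.sqrt r + (β - c) := by
        field_simp
      rw [this]
      have : 0 < 1 / Real.sqrt r := by positivity
      linarith
    · rw [min_eq_right h]
      nlinarith [mul_pos (mul_pos (sub_pos.2 hcβ) hsr) (sub_pos.2 hcβ)]
  -- assembly
  rw [← intervalIntegral.integral_add_adjacent_intervals (hi2 c H.cmem x₁ hx₁I) (hi2 x₁ hx₁I β hβI)]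
  refine (norm_add_le _ _).trans ?_
  have h0 : 0 ≤ 2 * A ^ 3 * (lam3 / r ^ 2) := by positivity
  nlinarith [hC1, hC2, mul_le_mul_of_nonneg_left hlog h0]

/-- **Uniform one-sided stationary phase.**  Under `LogStatPhaseHyp` (three derivatives on `[c, β]`, `r ≤ P'' ≤ Ar`,
`|P'''| ≤ λ₃`, `P'(c) = 0`, `c < β`), with NO term blowing up as `β ↓ c`:
`‖∫_c^β e^{iP(x)} dx − e^{iP(c)} P''(c)^{−1/2} fresnelS((2(P(β) − P(c)))^{1/2})‖ ≤ 2A³(λ₃/r²)(1 + log(1 + (β − c)√r))`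
(`fresnelS X = ∫_0^X e^{iu²/2} du`, the incomplete Fresnel integral of `StationaryPhase.lean`).
[cite: GrahamKolesnik1991, Lemma 3.4] [cite: Titchmarsh1986, Lemma 4.6] -/
theorem norm_integral_sub_fresnelS_le :
    ‖(∫ x in c..β, Complex.exp (I * P x))
        - Complex.exp (I * P c) * ((Real.sqrt (P'' c))⁻¹ : ℝ) * fresnelS (Real.sqrt (2 * (P β - P c)))‖
      ≤ 2 * A ^ 3 * (lam3 / r ^ 2) * (1 + Real.log (1 + (β - c) * Real.sqrt r)) := by
  have hcβ := H.hcβ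
  have hr := H.hr
  have hA := (lt_of_lt_of_le one_pos H.hA)
  have hA1 := H.hA
  have hl := H.lam3_nonneg
  have hβI : β ∈ Icc c β := right_mem_Icc.2 hcβ.le
  set E : ℝ → ℂ := fun x => Complex.exp (I * P x) with hE
  have hEc : ContinuousOn E (Icc c β) := continuousOn_exp_I_mul H.hP
  have hRc : ContinuousOn (fun x => (H.ratio x : ℂ)) (Icc c β) :=
    Complex.continuous_ofReal.comp_continuousOn H.continuousOn_ratio
  have hi1 : IntervalIntegrable (fun x => (H.ratio x : ℂ) * E x) volume c β :=
    ((hRc.mul hEc).mono (by rw [uIcc_of_le hcβ.le])).intervalIntegrable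
  have hi2 : IntervalIntegrable (fun x => ((1 - H.ratio x : ℝ) : ℂ) * E x) volume c β := by
    refine (ContinuousOn.mul ?_ hEc).mono (by rw [uIcc_of_le hcβ.le]) |>.intervalIntegrable
    exact Complex.continuous_ofReal.comp_continuousOn (continuousOn_const.sub H.continuousOn_ratio)
  -- `e^{iP} = τ' e^{iP} + (1 - τ') e^{iP}`, the first part being the Fresnel term EXACTLY
  have hsplit : (∫ x in c..β, E x) = (∫ x in c..β, (H.ratio x : ℂ) * E x)
      + ∫ x in c..β, ((1 - H.ratio x : ℝ) : ℂ) * E x := by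
    rw [← intervalIntegral.integral_add hi1 hi2]
    refine intervalIntegral.integral_congr fun x _ => ?_
    push_cast; ring
  have hmain : (∫ x in c..β, (H.ratio x : ℂ) * E x)
      = Complex.exp (I * P c) * ((Real.sqrt (P'' c))⁻¹ : ℝ) * fresnelS (Real.sqrt (2 * (P β - P c))) :=
    H.integral_ratio_mul_exp_eq_fresnelS
  rw [hsplit, hmain, add_sub_cancel_left]
  refine H.norm_integral_defect_le.trans ?_
  have hA3 : A * (lam3 / r ^ 2) ≤ 2 * A ^ 3 * (lam3 / r ^ 2) := by
    have : A ≤ 2 * A ^ 3 := by nlinarith [sq_nonneg A, hA1]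
    exact mul_le_mul_of_nonneg_right this (by positivity)
  nlinarith [hA3]

end LogStatPhaseHyp

/-! ### The statements with explicit hypotheses -/

/-- **Uniform stationary phase, stationary point at the LEFT end** (convex case): `P, P', P''` differentiable on `[c, β]`
(`HasDerivAt`, derivatives `P', P'', P'''`), `r ≤ P'' ≤ Ar`, `|P'''| ≤ λ₃` (`r > 0`, `A ≥ 1`), `P'(c) = 0`, `c < β`:
`‖∫_c^β e^{iP(x)} dx − e^{iP(c)} P''(c)^{−1/2} fresnelS((2(P(β) − P(c)))^{1/2})‖ ≤ 2A³(λ₃/r²)(1 + log(1 + (β − c)√r))`.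
[cite: GrahamKolesnik1991, Lemma 3.4] [cite: Titchmarsh1986, Lemma 4.6] -/
theorem stationaryPhase_uniform_right {P P' P'' P''' : ℝ → ℝ} {c β r A lam3 : ℝ} (hcβ : c < β)
    (hr : 0 < r) (hA : 1 ≤ A)
    (hP : ∀ x ∈ Icc c β, HasDerivAt P (P' x) x) (hP' : ∀ x ∈ Icc c β, HasDerivAt P' (P'' x) x)
    (hP'' : ∀ x ∈ Icc c β, HasDerivAt P'' (P''' x) x)
    (h2 : ∀ x ∈ Icc c β, r ≤ P'' x ∧ P'' x ≤ A * r) (h3 : ∀ x ∈ Icc c β, |P''' x| ≤ lam3) (hc : P' c = 0) :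
    ‖(∫ x in c..β, Complex.exp (I * P x))
        - Complex.exp (I * P c) * ((Real.sqrt (P'' c))⁻¹ : ℝ) * fresnelS (Real.sqrt (2 * (P β - P c)))‖
      ≤ 2 * A ^ 3 * (lam3 / r ^ 2) * (1 + Real.log (1 + (β - c) * Real.sqrt r)) :=
  (LogStatPhaseHyp.mk hcβ hr hA hP hP' hP'' h2 h3 hc).norm_integral_sub_fresnelS_le

/-- **Uniform stationary phase, stationary point at the RIGHT end** (convex case): `P, P', P''` differentiable on
`[α, c]`, `r ≤ P'' ≤ Ar`, `|P'''| ≤ λ₃`, `P'(c) = 0`, `α < c`: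
`‖∫_α^c e^{iP(x)} dx − e^{iP(c)} P''(c)^{−1/2} fresnelS((2(P(α) − P(c)))^{1/2})‖ ≤ 2A³(λ₃/r²)(1 + log(1 + (c − α)√r))`
(the reflection `x ↦ 2c − x` of the previous statement). [cite: GrahamKolesnik1991, Lemma 3.4] [cite: Titchmarsh1986, Lemma 4.6] -/
theorem stationaryPhase_uniform_left {P P' P'' P''' : ℝ → ℝ} {α c r A lam3 : ℝ} (hαc : α < c)
    (hr : 0 < r) (hA : 1 ≤ A)
    (hP : ∀ x ∈ Icc α c, HasDerivAt P (P' x) x) (hP' : ∀ x ∈ Icc α c, HasDerivAt P' (P'' x) x)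
    (hP'' : ∀ x ∈ Icc α c, HasDerivAt P'' (P''' x) x)
    (h2 : ∀ x ∈ Icc α c, r ≤ P'' x ∧ P'' x ≤ A * r) (h3 : ∀ x ∈ Icc α c, |P''' x| ≤ lam3) (hc : P' c = 0) :
    ‖(∫ x in α..c, Complex.exp (I * P x))
        - Complex.exp (I * P c) * ((Real.sqrt (P'' c))⁻¹ : ℝ) * fresnelS (Real.sqrt (2 * (P α - P c)))‖
      ≤ 2 * A ^ 3 * (lam3 / r ^ 2) * (1 + Real.log (1 + (c - α) * Real.sqrt r)) := by
  -- the reflection `y ↦ 2c - y` maps `[c, 2c - α]` onto `[α, c]`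
  have hrefl : ∀ y ∈ Icc c (2 * c - α), 2 * c - y ∈ Icc α c :=
    fun y hy => ⟨by linarith [hy.2], by linarith [hy.1]⟩
  have hd : ∀ y : ℝ, HasDerivAt (fun y : ℝ => 2 * c - y) (-1) y := fun y => by
    simpa using (hasDerivAt_id y).const_sub (2 * c)
  have hQ : ∀ y ∈ Icc c (2 * c - α), HasDerivAt (fun y => P (2 * c - y)) (-P' (2 * c - y)) y := by
    intro y hy
    have h := (hP (2 * c - y) (hrefl y hy)).comp y (hd y)
    exact h.congr_deriv (by ring)
  have hQ' : ∀ y ∈ Icc c (2 * c - α), HasDerivAt (fun y => -P' (2 * c - y)) (P'' (2 * c - y)) y := by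
    intro y hy
    have h := ((hP' (2 * c - y) (hrefl y hy)).comp y (hd y)).neg
    exact h.congr_deriv (by ring)
  have hQ'' : ∀ y ∈ Icc c (2 * c - α), HasDerivAt (fun y => P'' (2 * c - y)) (-P''' (2 * c - y)) y := by
    intro y hy
    have h := (hP'' (2 * c - y) (hrefl y hy)).comp y (hd y)
    exact h.congr_deriv (by ring)
  have HL : LogStatPhaseHyp (fun y => P (2 * c - y)) (fun y => -P' (2 * c - y)) (fun y => P'' (2 * c - y))
      (fun y => -P''' (2 * c - y)) c (2 * c - α) r A lam3 :=
    ⟨by linarith, hr, hA, hQ, hQ', hQ'', fun y hy => h2 _ (hrefl y hy),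
      fun y hy => by rw [abs_neg]; exact h3 _ (hrefl y hy), by rw [show 2 * c - c = c by ring, hc, neg_zero]⟩
  have hleft := HL.norm_integral_sub_fresnelS_le
  have hsub : (∫ y in c..(2 * c - α), Complex.exp (I * ((P (2 * c - y) : ℝ) : ℂ)))
      = ∫ x in α..c, Complex.exp (I * P x) := by
    rw [intervalIntegral.integral_comp_sub_left (fun x => Complex.exp (I * P x)) (2 * c)]
    congr 1 <;> ring
  simp only [hsub] at hleft
  rw [show 2 * c - c = c by ring, show 2 * c - (2 * c - α) = α by ring, show 2 * c - α - c = c - α by ring] at hleft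
  exact hleft

/-- **Uniform stationary phase, two-sided, end-points at or beyond the stationary point** (convex case): `P, P', P''`
differentiable on `[α, β]`, `r ≤ P'' ≤ Ar`, `|P'''| ≤ λ₃`, `P'(c) = 0`, `α ≤ c ≤ β` (`c = α` or `c = β` allowed):
`‖∫_α^β e^{iP} − e^{iP(c)} P''(c)^{−1/2} (fresnelS((2(P(α) − P(c)))^{1/2}) + fresnelS((2(P(β) − P(c)))^{1/2}))‖`
`  ≤ 2A³(λ₃/r²)(2 + log(1 + (c − α)√r) + log(1 + (β − c)√r))`.
For `c − α, β − c → ∞` the bracket tends to `2·fresnelLim = 𝔣` (`norm_fresnelS_sub_fresnelLim_le`), recovering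
`stationaryPhase_log`. [cite: GrahamKolesnik1991, Lemma 3.4] [cite: Titchmarsh1986, Lemma 4.6] -/
theorem stationaryPhase_uniform {P P' P'' P''' : ℝ → ℝ} {α β c r A lam3 : ℝ} (hαc : α ≤ c) (hcβ : c ≤ β)
    (hr : 0 < r) (hA : 1 ≤ A)
    (hP : ∀ x ∈ Icc α β, HasDerivAt P (P' x) x) (hP' : ∀ x ∈ Icc α β, HasDerivAt P' (P'' x) x)
    (hP'' : ∀ x ∈ Icc α β, HasDerivAt P'' (P''' x) x)
    (h2 : ∀ x ∈ Icc α β, r ≤ P'' x ∧ P'' x ≤ A * r) (h3 : ∀ x ∈ Icc α β, |P''' x| ≤ lam3) (hc : P' c = 0) :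
    ‖(∫ x in α..β, Complex.exp (I * P x))
        - Complex.exp (I * P c) * ((Real.sqrt (P'' c))⁻¹ : ℝ) *
            (fresnelS (Real.sqrt (2 * (P α - P c))) + fresnelS (Real.sqrt (2 * (P β - P c))))‖
      ≤ 2 * A ^ 3 * (lam3 / r ^ 2) *
          (2 + Real.log (1 + (c - α) * Real.sqrt r) + Real.log (1 + (β - c) * Real.sqrt r)) := by
  have hcI : c ∈ Icc α β := ⟨hαc, hcβ⟩
  have hl : 0 ≤ lam3 := (abs_nonneg _).trans (h3 c hcI)
  have hA0 : 0 < A := lt_of_lt_of_le one_pos hA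
  have hsubR : Icc c β ⊆ Icc α β := Icc_subset_Icc hαc le_rfl
  have hsubL : Icc α c ⊆ Icc α β := Icc_subset_Icc le_rfl hcβ
  set K : ℝ := 2 * A ^ 3 * (lam3 / r ^ 2) with hK
  have hK0 : 0 ≤ K := by positivity
  set M : ℂ := Complex.exp (I * P c) * ((Real.sqrt (P'' c))⁻¹ : ℝ) with hM
  -- right piece (possibly degenerate)
  have hright : ‖(∫ x in c..β, Complex.exp (I * P x)) - M * fresnelS (Real.sqrt (2 * (P β - P c)))‖
      ≤ K * (1 + Real.log (1 + (β - c) * Real.sqrt r)) := by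
    rcases hcβ.lt_or_eq with hlt | heq
    · exact stationaryPhase_uniform_right hlt hr hA (fun x hx => hP x (hsubR hx)) (fun x hx => hP' x (hsubR hx))
        (fun x hx => hP'' x (hsubR hx)) (fun x hx => h2 x (hsubR hx)) (fun x hx => h3 x (hsubR hx)) hc
    · subst heq
      simp only [intervalIntegral.integral_same, sub_self, mul_zero, Real.sqrt_zero, fresnelS, zero_mul,
        Real.log_one, add_zero, mul_one, norm_zero]
      exact hK0
  -- left piece (possibly degenerate)
  have hleft : ‖(∫ x in α..c, Complex.exp (I * P x)) - M * fresnelS (Real.sqrt (2 * (P α - P c)))‖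
      ≤ K * (1 + Real.log (1 + (c - α) * Real.sqrt r)) := by
    rcases hαc.lt_or_eq with hlt | heq
    · exact stationaryPhase_uniform_left hlt hr hA (fun x hx => hP x (hsubL hx)) (fun x hx => hP' x (hsubL hx))
        (fun x hx => hP'' x (hsubL hx)) (fun x hx => h2 x (hsubL hx)) (fun x hx => h3 x (hsubL hx)) hc
    · subst heq
      simp only [intervalIntegral.integral_same, sub_self, mul_zero, Real.sqrt_zero, fresnelS, zero_mul,
        Real.log_one, add_zero, mul_one, norm_zero]
      exact hK0
  -- assembly
  have hEc : ContinuousOn (fun x => Complex.exp (I * P x)) (Icc α β) := continuousOn_exp_I_mul hP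
  have hab : IntervalIntegrable (fun x => Complex.exp (I * P x)) volume α c :=
    (hEc.mono (by rw [uIcc_of_le hαc]; exact hsubL)).intervalIntegrable
  have hbc : IntervalIntegrable (fun x => Complex.exp (I * P x)) volume c β :=
    (hEc.mono (by rw [uIcc_of_le hcβ]; exact hsubR)).intervalIntegrable
  rw [← intervalIntegral.integral_add_adjacent_intervals hab hbc]
  calc ‖(∫ x in α..c, Complex.exp (I * P x)) + (∫ x in c..β, Complex.exp (I * P x))
        - M * (fresnelS (Real.sqrt (2 * (P α - P c))) + fresnelS (Real.sqrt (2 * (P β - P c))))‖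
      = ‖((∫ x in α..c, Complex.exp (I * P x)) - M * fresnelS (Real.sqrt (2 * (P α - P c))))
          + ((∫ x in c..β, Complex.exp (I * P x)) - M * fresnelS (Real.sqrt (2 * (P β - P c))))‖ := by ring_nf
    _ ≤ K * (1 + Real.log (1 + (c - α) * Real.sqrt r)) + K * (1 + Real.log (1 + (β - c) * Real.sqrt r)) :=
        (norm_add_le _ _).trans (add_le_add hleft hright)
    _ = K * (2 + Real.log (1 + (c - α) * Real.sqrt r) + Real.log (1 + (β - c) * Real.sqrt r)) := by ring

/-- **Uniform stationary phase, stationary point at the LEFT end, concave case** (`r ≤ −P'' ≤ Ar`; apply the convex case to `−P`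
and conjugate): main term `e^{iP(c)} |P''(c)|^{−1/2} conj(fresnelS((2(P(c) − P(β)))^{1/2}))`.
[cite: GrahamKolesnik1991, Lemma 3.4] [cite: Titchmarsh1986, Lemma 4.6] -/
theorem stationaryPhase_uniform_right_neg {P P' P'' P''' : ℝ → ℝ} {c β r A lam3 : ℝ} (hcβ : c < β)
    (hr : 0 < r) (hA : 1 ≤ A)
    (hP : ∀ x ∈ Icc c β, HasDerivAt P (P' x) x) (hP' : ∀ x ∈ Icc c β, HasDerivAt P' (P'' x) x)
    (hP'' : ∀ x ∈ Icc c β, HasDerivAt P'' (P''' x) x)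
    (h2 : ∀ x ∈ Icc c β, r ≤ -P'' x ∧ -P'' x ≤ A * r) (h3 : ∀ x ∈ Icc c β, |P''' x| ≤ lam3) (hc : P' c = 0) :
    ‖(∫ x in c..β, Complex.exp (I * P x))
        - Complex.exp (I * P c) * ((Real.sqrt (-P'' c))⁻¹ : ℝ) *
            (starRingEnd ℂ) (fresnelS (Real.sqrt (2 * (P c - P β))))‖
      ≤ 2 * A ^ 3 * (lam3 / r ^ 2) * (1 + Real.log (1 + (β - c) * Real.sqrt r)) := by
  have key := stationaryPhase_uniform_right (P := fun x => -P x) (P' := fun x => -P' x) (P'' := fun x => -P'' x)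
    (P''' := fun x => -P''' x) hcβ hr hA (fun x hx => (hP x hx).neg)
    (fun x hx => (hP' x hx).neg) (fun x hx => (hP'' x hx).neg) h2
    (fun x hx => by rw [abs_neg]; exact h3 x hx) (by simp [hc])
  have h1 : (starRingEnd ℂ) (∫ x in c..β, Complex.exp (I * ((-P x : ℝ) : ℂ)))
      = ∫ x in c..β, Complex.exp (I * P x) := by
    rw [intervalIntegral.integral_of_le hcβ.le, intervalIntegral.integral_of_le hcβ.le, ← integral_conj]
    refine setIntegral_congr_fun measurableSet_Ioc fun x _ => ?_
    rw [← Complex.exp_conj, map_mul, Complex.conj_I, Complex.conj_ofReal]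
    push_cast
    ring_nf
  have hv : 2 * (-P β - -P c) = 2 * (P c - P β) := by ring
  have h2c : (starRingEnd ℂ) (Complex.exp (I * ((-P c : ℝ) : ℂ)) * (((Real.sqrt (-P'' c))⁻¹ : ℝ) : ℂ)
        * fresnelS (Real.sqrt (2 * (-P β - -P c))))
      = Complex.exp (I * P c) * ((Real.sqrt (-P'' c))⁻¹ : ℝ) *
          (starRingEnd ℂ) (fresnelS (Real.sqrt (2 * (P c - P β)))) := by
    rw [map_mul, map_mul, Complex.conj_ofReal, ← Complex.exp_conj, map_mul, Complex.conj_I, Complex.conj_ofReal, hv]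
    push_cast
    ring_nf
  rw [← h1, ← h2c, ← map_sub, RCLike.norm_conj]
  exact key

end Literature.Analysis.Fourier

end
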